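import Literature.Computability.Complexity.TribesFunction
import Literature.Computability.Complexity.KKLTheorem
import Literature.Computability.Complexity.PromiseRPAmplification
import Mathlib.Algebra.Order.Ring.Pow
import HarnessLib

/-!
# The tribes function shows that the Kahn–Kalai–Linial theorem is sharp

Topic `Literature/Computability/Complexity` (companion of `KKLTheorem.lean` and `TribesFunction.lean`).  The tree's KKL
theorem (`LowDegree.KKL.kkl`): every `±1`-valued `f` on `{0,1}^m` has a coordinate with `Inf_i[f] ≥ (1/200)·Var[f]·ln m/m`.
Ben-Or and Linial's TRIBES function with `s = 2^w` tribes of width `w` (`m = w·2^w` bits) shows this is sharp up to the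
constant (O'Donnell 2014, §4.2 Prop. 4.12ff. and the discussion after the KKL theorem in §9.6): it is a roughly balanced
function (`Pr[Tribes = 0] = (1 − 2^{−w})^{2^w} ∈ [1/4, 1/2]`, so `Var ≥ 3/4` in the `±1` normalisation) all of whose
influences equal `2^{1−w}(1 − 2^{−w})^{2^w − 1} ≤ 2/2^w = 2w/m ≤ (2/ln 2)·ln m/m`.

* `quarter_le_one_sub_two_pow_inv_pow`, `one_sub_two_pow_inv_pow_le_half` — `1/4 ≤ (1 − 2^{−w})^{2^w} ≤ 1/2` (`w ≥ 1`);
* `kkl_influence_signedTribes_le` — every KKL influence of the `±1` tribes function on `Fin (s·w)` is `≤ 2/2^w`;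
* `kkl_variance_signedTribes_ge` — for `s = 2^w`, `w ≥ 1`: `Var ≥ 3/4`;
* **`kkl_sharp_tribes`** — `∀ w ≥ 1, ∃ f : {0,1}^{2^w·w} → {±1}, Var[f] ≥ 3/4 ∧ ∀ i, Inf_i[f] ≤ 2/2^w`;
* **`kkl_sharp_tribes_log`** — the same with the bound in KKL's currency: `Inf_i[f] ≤ (2/ln 2)·ln m/m`, `m = 2^w·w`.

Design: the `±1` tribes function is written inline as `x ↦ if Tribes(x ∘ finProdFinEquiv) then 1 else −1` (no new
definition); counting is transported from `TribesFunction.lean` along `finProdFinEquiv : Fin s × Fin w ≃ Fin (s·w)`.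

## References
* M. Ben-Or, N. Linial, *Collective coin flipping, robust voting schemes and minima of Banzhaf values*, FOCS 1985.
* J. Kahn, G. Kalai, N. Linial, *The influence of variables on Boolean functions*, FOCS 1988.
* R. O'Donnell, *Analysis of Boolean Functions*, Cambridge University Press 2014, §4.2 and §9.6.
-/

namespace Literature.Computability.Complexity

open Finset Function LowDegree LowDegree.KKL

/-! ### `1/4 ≤ (1 − 2^{−w})^{2^w} ≤ 1/2` -/

/-- `(1 − 2^{−w})^{2^w} ≤ 1/2` for `w ≥ 1` (the tree's `(1 − 1/n)^n ≤ 1/2` at `n = 2^w`).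
[cite: ODonnell2014, §4.2] -/
theorem one_sub_two_pow_inv_pow_le_half {w : ℕ} (hw : 1 ≤ w) :
    (1 - 1 / (2 : ℝ) ^ w) ^ (2 ^ w) ≤ 1 / 2 := by
  have h := one_sub_inv_pow_le_half (n := 2 ^ w) Nat.one_le_two_pow
  push_cast at h
  have hw' : w ≠ 0 := by omega
  simpa using h

/-- `1/4 ≤ (1 − 2^{−w})^{2^w}` for `w ≥ 1`: `(1 − 2^{−w})^{2^{w−1}} ≥ 1 − 2^{w−1}·2^{−w} = 1/2` by Bernoulli, then square.
[cite: ODonnell2014, §4.2] -/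
theorem quarter_le_one_sub_two_pow_inv_pow {w : ℕ} (hw : 1 ≤ w) :
    1 / 4 ≤ (1 - 1 / (2 : ℝ) ^ w) ^ (2 ^ w) := by
  obtain ⟨v, rfl⟩ : ∃ v, w = v + 1 := ⟨w - 1, by omega⟩
  have h2v : (0 : ℝ) < (2 : ℝ) ^ v := by positivity
  have hx : 1 / (2 : ℝ) ^ (v + 1) = (1 / 2) * (1 / (2 : ℝ) ^ v) := by rw [pow_succ]; field_simp
  have hB : (1 : ℝ) / 2 ≤ (1 - 1 / (2 : ℝ) ^ (v + 1)) ^ (2 ^ v) := by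
    have ha : (-2 : ℝ) ≤ -(1 / (2 : ℝ) ^ (v + 1)) := by
      have : 1 / (2 : ℝ) ^ (v + 1) ≤ 1 := by
        rw [div_le_one (by positivity)]; exact one_le_pow₀ (by norm_num)
      linarith
    have h := one_add_mul_le_pow ha (2 ^ v)
    have hprod : ((2 ^ v : ℕ) : ℝ) * -(1 / (2 : ℝ) ^ (v + 1)) = -(1 / 2) := by
      push_cast; rw [pow_succ]; field_simp
    rw [hprod, ← sub_eq_add_neg] at h
    have h' : (1 + -(1 / (2 : ℝ) ^ (v + 1))) ^ (2 ^ v) = (1 - 1 / (2 : ℝ) ^ (v + 1)) ^ (2 ^ v) := by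
      rw [← sub_eq_add_neg]
    linarith [h'.symm.le, h'.le]
  calc (1 : ℝ) / 4 = (1 / 2) ^ 2 := by norm_num
    _ ≤ ((1 - 1 / (2 : ℝ) ^ (v + 1)) ^ (2 ^ v)) ^ 2 := pow_le_pow_left₀ (by norm_num) hB 2
    _ = (1 - 1 / (2 : ℝ) ^ (v + 1)) ^ (2 ^ (v + 1)) := by rw [← pow_mul, ← pow_succ]

/-! ### Influences and variance of the `±1` tribes function -/

variable {s w : ℕ}

/-- **Every KKL influence of tribes is `≤ 2^{1−w}`.** For the `±1`-valued tribes function on `Fin (s·w)`,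
`Inf_i = #{x : Tribes(x) ≠ Tribes(x ⊕ e_i)}/2^{sw} = 2(2^w − 1)^{s−1}/2^{sw} ≤ 2/2^w`. [cite: ODonnell2014, §4.2] -/
theorem kkl_influence_signedTribes_le (i : Fin (s * w)) :
    KKL.influence i (fun x : Fin (s * w) → Bool =>
        if tribes s w (fun q => x (finProdFinEquiv q)) = true then (1 : ℝ) else -1) ≤ 2 / (2 : ℝ) ^ w := by
  classical
  set j : Fin s × Fin w := finProdFinEquiv.symm i with hj
  have hs : 1 ≤ s := j.1.pos
  unfold KKL.influence
  have h2 : (0 : ℝ) < (2 : ℝ) ^ (s * w) := by positivity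
  rw [div_le_div_iff₀ h2 (by positivity), Finset.sum_boole]
  -- the flip set, transported to the product index
  have hcount : ((Finset.univ : Finset (Fin (s * w) → Bool)).filter (fun x =>
      (if tribes s w (fun q => x (finProdFinEquiv q)) = true then (1 : ℝ) else -1) ≠
        (if tribes s w (fun q => update x i (!x i) (finProdFinEquiv q)) = true then (1 : ℝ) else -1))).card =
      2 * (2 ^ w - 1) ^ (s - 1) := by
    rw [← card_filter_tribes_ne_flip (s := s) (w := w) j, ← Fintype.card_subtype, ← Fintype.card_subtype]
    refine Fintype.card_congr (Equiv.subtypeEquiv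
      ((finProdFinEquiv (m := s) (n := w)).arrowCongr (Equiv.refl Bool)).symm fun x => ?_)
    have hxj : x (finProdFinEquiv j) = x i := by rw [hj, Equiv.apply_symm_apply]
    have hupd : (fun q => update x i (!x i) (finProdFinEquiv q)) =
        update (fun q => x (finProdFinEquiv q)) j (!x (finProdFinEquiv j)) := by
      rw [hxj]
      show update x i (!x i) ∘ finProdFinEquiv = _
      rw [update_comp_equiv]
      rfl
    show ((if tribes s w (fun q => x (finProdFinEquiv q)) = true then (1 : ℝ) else -1) ≠
        (if tribes s w (fun q => update x i (!x i) (finProdFinEquiv q)) = true then (1 : ℝ) else -1)) ↔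
      tribes s w (fun q => x (finProdFinEquiv q)) ≠
        tribes s w (update (fun q => x (finProdFinEquiv q)) j (!x (finProdFinEquiv j)))
    rw [hupd]
    rcases Bool.eq_false_or_eq_true (tribes s w (fun q => x (finProdFinEquiv q))) with h1 | h1 <;>
      rcases Bool.eq_false_or_eq_true (tribes s w (update (fun q => x (finProdFinEquiv q)) j
        (!x (finProdFinEquiv j)))) with h2' | h2' <;>
      simp [h1, h2'] <;> norm_num
  rw [hcount]
  have hle : ((2 * (2 ^ w - 1) ^ (s - 1) : ℕ) : ℝ) ≤ ((2 * (2 ^ w) ^ (s - 1) : ℕ) : ℝ) := by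
    exact_mod_cast Nat.mul_le_mul_left 2 (Nat.pow_le_pow_left (Nat.sub_le _ _) _)
  have hpow : ((2 * (2 ^ w) ^ (s - 1) : ℕ) : ℝ) * (2 : ℝ) ^ w = 2 * (2 : ℝ) ^ (s * w) := by
    obtain ⟨r, hr⟩ : ∃ r, s = r + 1 := ⟨s - 1, by omega⟩
    rw [hr, Nat.add_sub_cancel]
    push_cast
    rw [show (r + 1) * w = w * r + w by ring, pow_add, pow_mul]
    ring
  calc (((2 * (2 ^ w - 1) ^ (s - 1) : ℕ) : ℝ)) * (2 : ℝ) ^ w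
      ≤ ((2 * (2 ^ w) ^ (s - 1) : ℕ) : ℝ) * (2 : ℝ) ^ w := mul_le_mul_of_nonneg_right hle (by positivity)
    _ = 2 * (2 : ℝ) ^ (s * w) := hpow

/-- The mean of the `±1` tribes function: `E f = 1 − 2·#{Tribes = 0}/2^{sw} = 1 − 2(1 − 2^{−w})^s`.
[cite: ODonnell2014, §4.2] -/
theorem cubeFourierCoeff_empty_signedTribes (s w : ℕ) :
    cubeFourierCoeff (fun x : Fin (s * w) → Bool =>
        if tribes s w (fun q => x (finProdFinEquiv q)) = true then (1 : ℝ) else -1) ∅ =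
      1 - 2 * ((((2 ^ w - 1) ^ s : ℕ) : ℝ) / (2 : ℝ) ^ (s * w)) := by
  classical
  rw [cubeFourierCoeff_empty]
  have h2 : (0 : ℝ) < (2 : ℝ) ^ (s * w) := by positivity
  -- `Σ f = (#true) − (#false) = 2^{sw} − 2·#false`
  set Z := ((Finset.univ : Finset (Fin (s * w) → Bool)).filter
    (fun x => tribes s w (fun q => x (finProdFinEquiv q)) = false)) with hZ
  have hZcard : Z.card = (2 ^ w - 1) ^ s := by
    rw [hZ, ← card_filter_tribes_eq_false s w, ← Fintype.card_subtype, ← Fintype.card_subtype]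
    exact Fintype.card_congr (Equiv.subtypeEquiv
      ((finProdFinEquiv (m := s) (n := w)).arrowCongr (Equiv.refl Bool)).symm fun x => Iff.rfl)
  have hsum : ∑ x : Fin (s * w) → Bool,
      (if tribes s w (fun q => x (finProdFinEquiv q)) = true then (1 : ℝ) else -1) =
        (2 : ℝ) ^ (s * w) - 2 * Z.card := by
    have hpt : ∀ x : Fin (s * w) → Bool,
        (if tribes s w (fun q => x (finProdFinEquiv q)) = true then (1 : ℝ) else -1) =
          1 - 2 * (if tribes s w (fun q => x (finProdFinEquiv q)) = false then (1 : ℝ) else 0) := by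
      intro x
      cases tribes s w (fun q => x (finProdFinEquiv q)) <;> norm_num
    rw [Finset.sum_congr rfl fun x _ => hpt x, Finset.sum_sub_distrib, Finset.sum_const, Finset.card_univ,
      Fintype.card_fun, Fintype.card_bool, Fintype.card_fin, nsmul_eq_mul, mul_one, ← Finset.mul_sum,
      Finset.sum_boole, hZ]
    push_cast
    ring
  rw [hsum, hZcard]
  field_simp

/-- **The tribes function with `2^w` tribes is roughly balanced: `Var ≥ 3/4`** (`±1` normalisation,
`Var = 1 − (E f)² = 4P₀(1 − P₀)` with `P₀ = (1 − 2^{−w})^{2^w} ∈ [1/4, 1/2]`). [cite: ODonnell2014, §4.2] -/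
theorem kkl_variance_signedTribes_ge {w : ℕ} (hw : 1 ≤ w) :
    3 / 4 ≤ KKL.variance (fun x : Fin (2 ^ w * w) → Bool =>
        if tribes (2 ^ w) w (fun q => x (finProdFinEquiv q)) = true then (1 : ℝ) else -1) := by
  have hpm : ∀ x : Fin (2 ^ w * w) → Bool,
      (fun x : Fin (2 ^ w * w) → Bool =>
        if tribes (2 ^ w) w (fun q => x (finProdFinEquiv q)) = true then (1 : ℝ) else -1) x = 1 ∨
      (fun x : Fin (2 ^ w * w) → Bool =>
        if tribes (2 ^ w) w (fun q => x (finProdFinEquiv q)) = true then (1 : ℝ) else -1) x = -1 := by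
    intro x
    dsimp only
    cases tribes (2 ^ w) w (fun q => x (finProdFinEquiv q)) <;> simp
  rw [KKL.variance_eq _ hpm, cubeFourierCoeff_empty_signedTribes]
  set P0 : ℝ := (((2 ^ w - 1) ^ (2 ^ w) : ℕ) : ℝ) / (2 : ℝ) ^ (2 ^ w * w) with hP0
  have hP0eq : P0 = (1 - 1 / (2 : ℝ) ^ w) ^ (2 ^ w) := by
    rw [hP0, Nat.cast_pow, Nat.cast_sub Nat.one_le_two_pow, mul_comm (2 ^ w) w, pow_mul]
    push_cast
    rw [← div_pow]
    congr 1
    field_simp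
  have hlo := quarter_le_one_sub_two_pow_inv_pow hw
  have hhi := one_sub_two_pow_inv_pow_le_half hw
  rw [← hP0eq] at hlo hhi
  nlinarith

/-- **KKL is sharp (Ben-Or–Linial tribes).** For every `w ≥ 1` there is a `±1`-valued function on `m = 2^w·w` bits
with `Var ≥ 3/4` all of whose influences are `≤ 2/2^w = 2w/m`. [cite: ODonnell2014, §4.2] -/
theorem kkl_sharp_tribes {w : ℕ} (hw : 1 ≤ w) :
    ∃ f : (Fin (2 ^ w * w) → Bool) → ℝ, (∀ x, f x = 1 ∨ f x = -1) ∧ 3 / 4 ≤ KKL.variance f ∧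
      ∀ i, KKL.influence i f ≤ 2 / (2 : ℝ) ^ w := by
  refine ⟨fun x => if tribes (2 ^ w) w (fun q => x (finProdFinEquiv q)) = true then (1 : ℝ) else -1,
    fun x => ?_, kkl_variance_signedTribes_ge hw, fun i => kkl_influence_signedTribes_le i⟩
  dsimp only
  cases tribes (2 ^ w) w (fun q => x (finProdFinEquiv q)) <;> simp

/-- **KKL is sharp, in KKL's currency.** For every `w ≥ 1`, on `m = 2^w·w` bits there is a `±1`-valued `f` with
`Var[f] ≥ 3/4` and every `Inf_i[f] ≤ (2/ln 2)·ln m/m` — matching `LowDegree.KKL.kkl`'s `Inf ≥ (1/200)·Var·ln m/m` up to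
the constant. [cite: ODonnell2014, §9.6] -/
theorem kkl_sharp_tribes_log {w : ℕ} (hw : 1 ≤ w) :
    ∃ f : (Fin (2 ^ w * w) → Bool) → ℝ, (∀ x, f x = 1 ∨ f x = -1) ∧ 3 / 4 ≤ KKL.variance f ∧
      ∀ i, KKL.influence i f ≤
        2 / Real.log 2 * (Real.log ((2 ^ w * w : ℕ) : ℝ) / ((2 ^ w * w : ℕ) : ℝ)) := by
  obtain ⟨f, hf, hvar, hinf⟩ := kkl_sharp_tribes hw
  refine ⟨f, hf, hvar, fun i => (hinf i).trans ?_⟩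
  have hlog2 : 0 < Real.log 2 := Real.log_pos one_lt_two
  have hw0 : (0 : ℝ) < w := by exact_mod_cast hw
  have h2w : (0 : ℝ) < (2 : ℝ) ^ w := by positivity
  set m : ℝ := ((2 ^ w * w : ℕ) : ℝ) with hm
  have hm' : m = (2 : ℝ) ^ w * w := by rw [hm]; push_cast; ring
  have hm0 : 0 < m := by rw [hm']; positivity
  -- `log m ≥ w log 2`
  have hlogm : (w : ℝ) * Real.log 2 ≤ Real.log m := by
    rw [hm', Real.log_mul h2w.ne' hw0.ne', Real.log_pow]
    have : 0 ≤ Real.log w := Real.log_nonneg (by exact_mod_cast hw)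
    linarith
  -- `2/2^w = 2w/m ≤ (2/log 2)(log m/m)`
  have h1 : 2 / (2 : ℝ) ^ w = 2 * w / m := by rw [hm']; field_simp
  rw [h1, div_mul_div_comm, div_le_div_iff₀ hm0 (by positivity)]
  nlinarith [hlogm, hm0, hlog2]

end Literature.Computability.Complexity
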